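import Summits.ResolutionOfSingularities.ResolutionOfSingularities.Theorems.EquisingularLiftEquisingularLiftNatHostedPointStepSeam
import Summits.ResolutionOfSingularities.ResolutionOfSingularities.Theorems.EquisingularLiftEquisingularLiftNatHyperplaneLetterThroughSection
import Summits.ResolutionOfSingularities.ResolutionOfSingularities.Theorems.EquisingularLiftEquisingularLiftNatPreLetterPointStep
import Summits.ResolutionOfSingularities.ResolutionOfSingularities.Theorems.EquisingularLiftEquisingularLiftNatPointPlaneModel
import Summits.ResolutionOfSingularities.ResolutionOfSingularities.Theorems.EquisingularLiftEquisingularLiftNatModelChainStep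
import Summits.ResolutionOfSingularities.ResolutionOfSingularities.Theorems.EquisingularLiftEquisingularLiftNatCarrierDeltaComapFrame
import HarnessLib

/-!
# [OURS · L1 W4.5(b) · EL♮(3) · WIDTH TABLE D5 «IMMATURE HOST», supplier row HOPEN, part 1] THE OPENING'S POINT PHASE
# `TCPlus.opening_pointPhase k H ι hBirth hG1P …` — birth of all models at the initial stage, the K5′ point step at `x₀`, every model transported

res-L1-w45b-stub-2 g16 (desk R54: «HOPEN assembly = stub-2»; input spec (IN-1)–(IN-4) of this seat's STATUS line 2026-08-28T21:44Z).  OURS; NOT a statement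
of any manuscript ([Hironaka2017] is a candidate under adjudication, nothing of it is asserted); AI-written, weaker than expert review.  No `sorry`; standard
axioms; DEF-FREE; TWO lemma-shaped ∀-hypotheses (ordinary theorems to be landed by their own files, NOT named facts): **(IN-1) `hBirth`** — the JOINT BIRTH at
the concrete initial stage `ℙ³_O` (res-type-027's Proj plumbing, H2/H3 style): given the K5′ section `s` through `g x₀`, the hyperplane letters' forms, the
key form `G` in the (host, face) gauge of `OpeningCertKeyLetter` (✓ Defs8 p671016) with its (A2) radical certificate, produce models `𝓛 ℓ ≤ ker s` with the
five `LetterDatum` clauses, and the key model `𝓜` with the four pre-letter clauses, `𝓜 ≠ ⊥`, the GAUGE MEMBERSHIP `𝓜 ≤ (𝓛 ℓh)^a ⊔ 𝓛 ℓh * (ker s)^a ⊔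
(ker s)^a * 𝓛 ℓj` and Δ2a's stalk triple at `g x₀`; **(IN-2) `hG1P`** — res-L1-w45b-stub-4's G1 rule through a section blow-up: from that membership and
the exact order `a` at the section's closed point, `St 𝓜 ≤ (St 𝓛h)^a ⊔ St 𝓛h * 𝓢 ⊔ 𝓢 * St 𝓛j` (`St := strictTransformIdeal τ (ker s)`, `𝓢 := (ker s)·𝒪_{X₁}`).
`--supports stmt-ResolutionOfSingularities-20148 --as helper`.

WHAT.  In the engine's INITIAL-STAGE context (HSUB₂'s / HOPEN's binder prefix, verbatim, `n = 3`) and for the opening data of `OpeningCertKeyLetter` up to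
the point step (the closed non-regular point `x₀` of `H̃`, regular on `ℙ³_k`; `υ = Bl_{x₀}`; letters `ℓh :: ℓj :: ℓs` through `x₀` off `H`; key form
`G = ℓh^a·U + ℓh·R₁ + R₂·ℓj`, `Rᵢ ∈ 𝔭^a`, `U ∉ 𝔭`, `2 ≤ a`, `H ⊄ V₊(G)`, (A2)): THE STAGE AFTER THE POINT STEP with EVERY MODEL EXPLICIT — the K5′
section `s` and blow-up `τ = Bl_{ker s}` with its `Ch`-stage and model square for `F₂` (✓ `modelPointStep_chain'`), the exceptional letter `υ⁻¹{x₀}`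
with the model `(ker s)·𝒪_{X₁}` (res-L1-w45b-lead-1's ✓ `pointPlane_model`), every hyperplane letter `St V₊(ℓ)` with the model `St (𝓛 ℓ)` (res-L1-w45b-stub-4's
✓ HT1 `hostClauses_strictTransform_of_nestedSection`), the immature key letter `St V₊(G)` with the model `St 𝓜` and its four pre-letter clauses
(✓ Δ2a `preLetterClauses_strictTransform_of_section`), and the transported incidence of (IN-2).  Part 2 (the CAR pair round, PROMOTE, the outputs of
`OpeningCertKeyLetter`) consumes exactly this tuple. [folklore; pure composition of the cited tree theorems]
-/

set_option linter.dupNamespace false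
set_option linter.overlappingInstances false

noncomputable section

open CategoryTheory CategoryTheory.Limits AlgebraicGeometry TopologicalSpace Topology IsLocalRing MvPolynomial
open Literature.AlgebraicGeometry.Motives (projectiveSpace)
open Literature.AlgebraicGeometry.Resolution AlgebraicGeometry.Scheme.IdealSheafData
open Summit.ResolutionOfSingularities.ResolutionOfSingularities.Theses.EquisingularLift.Split
open Summit.ResolutionOfSingularities.ResolutionOfSingularities.Cruxes.EquisingularLift.StrataSplit

namespace Summit.ResolutionOfSingularities.ResolutionOfSingularities.Cruxes.EquisingularLiftNat.Sections

/-- **HOPEN part 1 — the opening's POINT PHASE with every model explicit** (see the module docstring), modulo (IN-1) the joint birth and (IN-2)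
the G1 rule through the section blow-up. [folklore; pure composition] [OURS · L1 W4.5b · WIDTH TABLE D5, supplier row HOPEN part 1] -/
theorem TCPlus.opening_pointPhase (k : Type) [Field k] [IsAlgClosed k] (H : Scheme.{0}) (ι : H ⟶ (projectiveSpace 3 k).left) [IsIntegral H] [IsClosedImmersion ι]
    (hBirth : (∀ (O : Type) [CommRing O] [IsDomain O] [IsDiscreteValuationRing O] [IsAdicComplete (IsLocalRing.maximalIdeal O) O] [IsAlgClosed (IsLocalRing.ResidueField O)]
        (θ : O →+* k), Function.Surjective θ → (letI := MvPolynomial.gradedAlgebra (σ := Fin (3 + 1)) (R := O); letI := MvPolynomial.gradedAlgebra (σ := Fin (3 + 1)) (R := k);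
      ∀ (φ : homogeneousSubmodule (Fin (3 + 1)) O →+*ᵍ homogeneousSubmodule (Fin (3 + 1)) k)
        (hφ' : HomogeneousIdeal.irrelevant (homogeneousSubmodule (Fin (3 + 1)) k) ≤ (HomogeneousIdeal.irrelevant (homogeneousSubmodule (Fin (3 + 1)) O)).map φ),
        (∀ s, φ s = MvPolynomial.map θ s) →
      ∀ (s : Spec (.of O) ⟶ (Proj (homogeneousSubmodule (Fin (3 + 1)) O))), s ≫ (Proj.toSpecZero (homogeneousSubmodule (Fin (3 + 1)) O) ≫ Spec.map (CommRingCat.ofHom (algebraMap O (homogeneousSubmodule (Fin (3 + 1)) O 0)))) = 𝟙 _ →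
      ∀ (x₀ : (projectiveSpace 3 k).left), s (IsLocalRing.closedPoint O) = (Proj.map φ hφ' : (projectiveSpace 3 k).left ⟶ Proj (homogeneousSubmodule (Fin (3 + 1)) O)) x₀ →
      ∀ (ℓh ℓj : MvPolynomial (Fin (3 + 1)) k) (ℓs : List (MvPolynomial (Fin (3 + 1)) k)) (G U R₁ R₂ : MvPolynomial (Fin (3 + 1)) k) (e a : ℕ),
        (∀ ℓ ∈ ℓh :: ℓj :: ℓs, ℓ.IsHomogeneous 1 ∧ ℓ ≠ 0 ∧ x₀ ∈ {y : (projectiveSpace 3 k).left | ℓ ∈ (y : ProjectiveSpectrum (homogeneousSubmodule (Fin (3 + 1)) k)).asHomogeneousIdeal} ∧ ¬ (Set.range ι ⊆ {y : (projectiveSpace 3 k).left | ℓ ∈ (y : ProjectiveSpectrum (homogeneousSubmodule (Fin (3 + 1)) k)).asHomogeneousIdeal})) →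
        G.IsHomogeneous e → 2 ≤ a → G = ℓh ^ a * U + ℓh * R₁ + R₂ * ℓj → R₁ ∈ ((x₀ : ProjectiveSpectrum (homogeneousSubmodule (Fin (3 + 1)) k)).asHomogeneousIdeal).toIdeal ^ a → R₂ ∈ ((x₀ : ProjectiveSpectrum (homogeneousSubmodule (Fin (3 + 1)) k)).asHomogeneousIdeal).toIdeal ^ a → U ∉ ((x₀ : ProjectiveSpectrum (homogeneousSubmodule (Fin (3 + 1)) k)).asHomogeneousIdeal) →
        ¬ (Set.range ι ⊆ {y : (projectiveSpace 3 k).left | G ∈ (y : ProjectiveSpectrum (homogeneousSubmodule (Fin (3 + 1)) k)).asHomogeneousIdeal}) → (∀ i : Fin (3 + 1), (Ideal.span {MvPolynomial.aeval (Function.update MvPolynomial.X i (1 : MvPolynomial (Fin (3 + 1)) k)) G}).IsRadical) →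
        ∃ (𝓛 : MvPolynomial (Fin (3 + 1)) k → ((Proj (homogeneousSubmodule (Fin (3 + 1)) O))).IdealSheafData) (𝓜 : ((Proj (homogeneousSubmodule (Fin (3 + 1)) O))).IdealSheafData) (Gst : ((Proj (homogeneousSubmodule (Fin (3 + 1)) O))).presheaf.stalk ((Proj.map φ hφ' : (projectiveSpace 3 k).left ⟶ Proj (homogeneousSubmodule (Fin (3 + 1)) O)) x₀)),
          (∀ ℓ ∈ ℓh :: ℓj :: ℓs, ((𝓛 ℓ).comap (Proj.map φ hφ' : (projectiveSpace 3 k).left ⟶ Proj (homogeneousSubmodule (Fin (3 + 1)) O)) = vanishingIdeal (⟨closure {y : (projectiveSpace 3 k).left | ℓ ∈ (y : ProjectiveSpectrum (homogeneousSubmodule (Fin (3 + 1)) k)).asHomogeneousIdeal}, isClosed_closure⟩ : Closeds (projectiveSpace 3 k).left) ∧ (∀ z : ↥(Proj (homogeneousSubmodule (Fin (3 + 1)) O)), (stalkIdeal (𝓛 ℓ) z).IsPrincipal) ∧ Scheme.IsRegular (𝓛 ℓ).subscheme ∧ (𝟙 (Proj (homogeneousSubmodule (Fin (3 + 1)) O))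 : _ ⟶ _) '' ((𝓛 ℓ).support : Set ↥(Proj (homogeneousSubmodule (Fin (3 + 1)) O))) ⊆ {y : ↥(Proj (homogeneousSubmodule (Fin (3 + 1)) O)) | ¬ IsGenericPoint y (Set.range (ι ≫ Proj.map φ hφ' : H ⟶ Proj (homogeneousSubmodule (Fin (3 + 1)) O)))} ∧ Flat ((𝓛 ℓ).subschemeι ≫ 𝟙 (Proj (homogeneousSubmodule (Fin (3 + 1)) O)) ≫ (Proj.toSpecZero (homogeneousSubmodule (Fin (3 + 1)) O) ≫ Spec.map (CommRingCat.ofHom (algebraMap O (homogeneousSubmodule (Fin (3 + 1)) O 0)))))) ∧ 𝓛 ℓ ≤ s.ker) ∧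
          ((𝓜).comap (Proj.map φ hφ' : (projectiveSpace 3 k).left ⟶ Proj (homogeneousSubmodule (Fin (3 + 1)) O)) = vanishingIdeal (⟨closure {y : (projectiveSpace 3 k).left | G ∈ (y : ProjectiveSpectrum (homogeneousSubmodule (Fin (3 + 1)) k)).asHomogeneousIdeal}, isClosed_closure⟩ : Closeds (projectiveSpace 3 k).left) ∧ (∀ z : ↥(Proj (homogeneousSubmodule (Fin (3 + 1)) O)), (stalkIdeal (𝓜) z).IsPrincipal) ∧ (𝟙 (Proj (homogeneousSubmodule (Fin (3 + 1)) O)) : _ ⟶ _) '' ((𝓜).support : Set ↥(Proj (homogeneousSubmodule (Fin (3 + 1)) O))) ⊆ {y : ↥(Proj (homogeneousSubmodule (Fin (3 + 1)) O)) | ¬ IsGenericPoint y (Set.range (ι ≫ Proj.map φ hφ' : H ⟶ Proj (homogeneousSubmodule (Fin (3 + 1)) O)))} ∧ Flat ((𝓜).subschemeι ≫ 𝟙 (Proj (homogeneousSubmodule (Fin (3 + 1)) O)) ≫ (Proj.toSpecZero (homogeneousSubmodule (Fin (3 + 1)) O) ≫ Spec.map (CommRingCat.ofHom (algebraMap O (homogeneousSubmodule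 (Fin (3 + 1)) O 0)))))) ∧ 𝓜 ≠ ⊥ ∧
          𝓜 ≤ (𝓛 ℓh) ^ a ⊔ 𝓛 ℓh * s.ker ^ a ⊔ s.ker ^ a * 𝓛 ℓj ∧
          stalkIdeal 𝓜 ((Proj.map φ hφ' : (projectiveSpace 3 k).left ⟶ Proj (homogeneousSubmodule (Fin (3 + 1)) O)) x₀) = Ideal.span {Gst} ∧ Gst ∈ stalkIdeal s.ker ((Proj.map φ hφ' : (projectiveSpace 3 k).left ⟶ Proj (homogeneousSubmodule (Fin (3 + 1)) O)) x₀) ^ a ∧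
          ((Proj.map φ hφ' : (projectiveSpace 3 k).left ⟶ Proj (homogeneousSubmodule (Fin (3 + 1)) O)).stalkMap x₀).hom Gst ∉ IsLocalRing.maximalIdeal (((projectiveSpace 3 k).left).presheaf.stalk x₀) ^ (a + 1))))
    (hG1P : (∀ (O : Type) [CommRing O] [IsDomain O] [IsDiscreteValuationRing O] {X' X₁ : Scheme.{0}} [IsIntegral X'] [IsLocallyNoetherian X'] [IsLocallyNoetherian X₁],
        Scheme.IsRegular X' → ∀ (r' : X' ⟶ Spec (.of O)) [IsSeparated r'] (s : Spec (.of O) ⟶ X'), s ≫ r' = 𝟙 _ →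
        ∀ (τ : X₁ ⟶ X'), IsBlowup τ s.ker →
        -- two letters through the section (regular principal models containing it) and the immature key letter of exact order `a` at the section's closed point
        ∀ (𝓛h 𝓛j 𝓜 : X'.IdealSheafData) (a : ℕ) (x' : X'), s (IsLocalRing.closedPoint O) = x' → 𝓛h ≤ s.ker → 𝓛j ≤ s.ker →
          Scheme.IsRegular 𝓛h.subscheme → (∀ z : X', (stalkIdeal 𝓛h z).IsPrincipal) → Scheme.IsRegular 𝓛j.subscheme → (∀ z : X', (stalkIdeal 𝓛j z).IsPrincipal) →
          (∀ z : X', (stalkIdeal 𝓜 z).IsPrincipal) → 𝓜 ≠ ⊥ →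
          (∃ Gst : X'.presheaf.stalk x', stalkIdeal 𝓜 x' = Ideal.span {Gst} ∧ Gst ∈ stalkIdeal s.ker x' ^ a ∧ Gst ∉ IsLocalRing.maximalIdeal (X'.presheaf.stalk x') ^ (a + 1)) →
          𝓜 ≤ 𝓛h ^ a ⊔ 𝓛h * s.ker ^ a ⊔ s.ker ^ a * 𝓛j →
          strictTransformIdeal τ s.ker 𝓜 ≤ strictTransformIdeal τ s.ker 𝓛h ^ a ⊔ strictTransformIdeal τ s.ker 𝓛h * s.ker.comap τ ⊔ s.ker.comap τ * strictTransformIdeal τ s.ker 𝓛j))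
    -- the engine's INITIAL-STAGE context (HSUB₂'s / HOPEN's binder prefix, verbatim)
    (O : Type) [CommRing O] [IsDomain O] [IsDiscreteValuationRing O] [IsAdicComplete (IsLocalRing.maximalIdeal O) O] [IsAlgClosed (IsLocalRing.ResidueField O)]
    (θ : O →+* k) (hθ : Function.Surjective θ) :
    letI := MvPolynomial.gradedAlgebra (σ := Fin (3 + 1)) (R := O); letI := MvPolynomial.gradedAlgebra (σ := Fin (3 + 1)) (R := k);
    ∀ (φ : homogeneousSubmodule (Fin (3 + 1)) O →+*ᵍ homogeneousSubmodule (Fin (3 + 1)) k)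
      (hφ' : HomogeneousIdeal.irrelevant (homogeneousSubmodule (Fin (3 + 1)) k) ≤ (HomogeneousIdeal.irrelevant (homogeneousSubmodule (Fin (3 + 1)) O)).map φ),
      (∀ s, φ s = MvPolynomial.map θ s) →
    ∀ (Ch : ∀ X' : Scheme.{0}, (X' ⟶ (Proj (homogeneousSubmodule (Fin (3 + 1)) O))) → Set X' → Prop),
      (∀ (X' X'' : Scheme.{0}) (σ' : X' ⟶ (Proj (homogeneousSubmodule (Fin (3 + 1)) O))) (S' : Set X') (C : X'.IdealSheafData) (τ : X'' ⟶ X'),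
        Ch X' σ' S' → IsBlowup τ C → Scheme.IsRegular C.subscheme → Flat (C.subschemeι ≫ σ' ≫ (Proj.toSpecZero (homogeneousSubmodule (Fin (3 + 1)) O) ≫ Spec.map (CommRingCat.ofHom (algebraMap O (homogeneousSubmodule (Fin (3 + 1)) O 0))))) →
        σ' '' (C.support : Set X') ⊆ {y : ↥(Proj (homogeneousSubmodule (Fin (3 + 1)) O)) | ¬ IsGenericPoint y (Set.range (ι ≫ Proj.map φ hφ' : H ⟶ Proj (homogeneousSubmodule (Fin (3 + 1)) O)))} → (C.support : Set X') ∩ (σ' ≫ (Proj.toSpecZero (homogeneousSubmodule (Fin (3 + 1)) O) ≫ Spec.map (CommRingCat.ofHom (algebraMap O (homogeneousSubmodule (Fin (3 + 1)) O 0))))) ⁻¹' {IsLocalRing.closedPoint O} ⊆ S' →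
        Ch X'' (τ ≫ σ') (closure (τ ⁻¹' (S' \ (C.support : Set X'))))) →
      (∀ (X' : Scheme.{0}) (σ' : X' ⟶ (Proj (homogeneousSubmodule (Fin (3 + 1)) O))) (S' : Set X'), Ch X' σ' S' → Chain (Proj (homogeneousSubmodule (Fin (3 + 1)) O)) (Set.range (ι ≫ Proj.map φ hφ' : H ⟶ Proj (homogeneousSubmodule (Fin (3 + 1)) O))) X' σ' S') →
      (Set.range (ι ≫ Proj.map φ hφ' : H ⟶ Proj (homogeneousSubmodule (Fin (3 + 1)) O))) ⊆ (Proj.toSpecZero (homogeneousSubmodule (Fin (3 + 1)) O) ≫ Spec.map (CommRingCat.ofHom (algebraMap O (homogeneousSubmodule (Fin (3 + 1)) O 0)))) ⁻¹' {IsLocalRing.closedPoint O} → IsIrreducible (Set.range (ι ≫ Proj.map φ hφ' : H ⟶ Proj (homogeneousSubmodule (Fin (3 + 1)) O))) → IsClosed (Set.range (ι ≫ Proj.map φ hφ' : H ⟶ Proj (homogeneousSubmodule (Fin (3 + 1)) O))) →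
      IsIntegral (Proj (homogeneousSubmodule (Fin (3 + 1)) O)) → IsLocallyNoetherian (Proj (homogeneousSubmodule (Fin (3 + 1)) O)) → Scheme.IsRegular (Proj (homogeneousSubmodule (Fin (3 + 1)) O)) → IsProper (Proj.toSpecZero (homogeneousSubmodule (Fin (3 + 1)) O) ≫ Spec.map (CommRingCat.ofHom (algebraMap O (homogeneousSubmodule (Fin (3 + 1)) O 0)))) → SmoothOfRelativeDimension 3 (Proj.toSpecZero (homogeneousSubmodule (Fin (3 + 1)) O) ≫ Spec.map (CommRingCat.ofHom (algebraMap O (homogeneousSubmodule (Fin (3 + 1)) O 0)))) →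
      Ch (Proj (homogeneousSubmodule (Fin (3 + 1)) O)) (𝟙 (Proj (homogeneousSubmodule (Fin (3 + 1)) O))) (Set.range (ι ≫ Proj.map φ hφ' : H ⟶ Proj (homogeneousSubmodule (Fin (3 + 1)) O))) → IsDominant (𝟙 (Proj (homogeneousSubmodule (Fin (3 + 1)) O)) ≫ (Proj.toSpecZero (homogeneousSubmodule (Fin (3 + 1)) O) ≫ Spec.map (CommRingCat.ofHom (algebraMap O (homogeneousSubmodule (Fin (3 + 1)) O 0))))) → IsIntegral (projectiveSpace 3 k).left →
    ∀ (t : (projectiveSpace 3 k).left ⟶ Spec (.of k)), IsPullback (Proj.map φ hφ' : (projectiveSpace 3 k).left ⟶ Proj (homogeneousSubmodule (Fin (3 + 1)) O)) t (𝟙 (Proj (homogeneousSubmodule (Fin (3 + 1)) O)) ≫ (Proj.toSpecZero (homogeneousSubmodule (Fin (3 + 1)) O) ≫ Spec.map (CommRingCat.ofHom (algebraMap O (homogeneousSubmodule (Fin (3 + 1)) O 0))))) (Spec.map (CommRingCat.ofHom θ)) →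
      IsClosed (Set.range ι) → IsIrreducible (Set.range ι) → (Proj.map φ hφ' : (projectiveSpace 3 k).left ⟶ Proj (homogeneousSubmodule (Fin (3 + 1)) O)) '' Set.range ι = (Set.range (ι ≫ Proj.map φ hφ' : H ⟶ Proj (homogeneousSubmodule (Fin (3 + 1)) O))) →
    -- the OPENING data up to the point step: the point, its blow-up, the letters, the key form (conjuncts of `OpeningCertKeyLetter`)
    ∀ (x₀ : ↥(vanishingIdeal (⟨closure (Set.range ι), isClosed_closure⟩ : Closeds (projectiveSpace 3 k).left)).subscheme) (hx₀ : IsClosed ({((vanishingIdeal (⟨closure (Set.range ι), isClosed_closure⟩ : Closeds (projectiveSpace 3 k).left)).subschemeι x₀ : (projectiveSpace 3 k).left)} : Set (projectiveSpace 3 k).left)),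
      ¬ IsRegularLocalRing ((vanishingIdeal (⟨closure (Set.range ι), isClosed_closure⟩ : Closeds (projectiveSpace 3 k).left)).subscheme.presheaf.stalk x₀) →
      IsRegularLocalRing (((projectiveSpace 3 k).left).presheaf.stalk ((vanishingIdeal (⟨closure (Set.range ι), isClosed_closure⟩ : Closeds (projectiveSpace 3 k).left)).subschemeι x₀ : (projectiveSpace 3 k).left)) →
    ∀ (F₂ : Scheme.{0}) (υ : F₂ ⟶ (projectiveSpace 3 k).left), IsBlowup υ (vanishingIdeal (⟨{((vanishingIdeal (⟨closure (Set.range ι), isClosed_closure⟩ : Closeds (projectiveSpace 3 k).left)).subschemeι x₀ : (projectiveSpace 3 k).left)}, hx₀⟩ : Closeds (projectiveSpace 3 k).left)) →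
    ∀ (ℓh ℓj : MvPolynomial (Fin (3 + 1)) k) (ℓs : List (MvPolynomial (Fin (3 + 1)) k)) (G U R₁ R₂ : MvPolynomial (Fin (3 + 1)) k) (e a : ℕ),
      (∀ ℓ ∈ ℓh :: ℓj :: ℓs, ℓ.IsHomogeneous 1 ∧ ℓ ≠ 0 ∧ ((vanishingIdeal (⟨closure (Set.range ι), isClosed_closure⟩ : Closeds (projectiveSpace 3 k).left)).subschemeι x₀ : (projectiveSpace 3 k).left) ∈ {y : (projectiveSpace 3 k).left | ℓ ∈ (y : ProjectiveSpectrum (homogeneousSubmodule (Fin (3 + 1)) k)).asHomogeneousIdeal} ∧ ¬ (Set.range ι ⊆ {y : (projectiveSpace 3 k).left | ℓ ∈ (y : ProjectiveSpectrum (homogeneousSubmodule (Fin (3 + 1)) k)).asHomogeneousIdeal})) →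
      G.IsHomogeneous e → 2 ≤ a → G = ℓh ^ a * U + ℓh * R₁ + R₂ * ℓj → R₁ ∈ ((((vanishingIdeal (⟨closure (Set.range ι), isClosed_closure⟩ : Closeds (projectiveSpace 3 k).left)).subschemeι x₀ : (projectiveSpace 3 k).left) : ProjectiveSpectrum (homogeneousSubmodule (Fin (3 + 1)) k)).asHomogeneousIdeal).toIdeal ^ a → R₂ ∈ ((((vanishingIdeal (⟨closure (Set.range ι), isClosed_closure⟩ : Closeds (projectiveSpace 3 k).left)).subschemeι x₀ : (projectiveSpace 3 k).left) : ProjectiveSpectrum (homogeneousSubmodule (Fin (3 + 1)) k)).asHomogeneousIdeal).toIdeal ^ a → U ∉ ((((vanishingIdeal (⟨closure (Set.range ι), isClosed_closure⟩ : Closeds (projectiveSpace 3 k).left)).subschemeι x₀ : (projectiveSpace 3 k).left) : ProjectiveSpectrum (homogeneousSubmodule (Fin (3 + 1)) k)).asHomogeneousIdeal) →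
      ¬ (Set.range ι ⊆ {y : (projectiveSpace 3 k).left | G ∈ (y : ProjectiveSpectrum (homogeneousSubmodule (Fin (3 + 1)) k)).asHomogeneousIdeal}) → (∀ i : Fin (3 + 1), (Ideal.span {MvPolynomial.aeval (Function.update MvPolynomial.X i (1 : MvPolynomial (Fin (3 + 1)) k)) G}).IsRadical) →
    -- THE STAGE AFTER THE POINT STEP, with every model explicit
    ∃ (s : Spec (.of O) ⟶ (Proj (homogeneousSubmodule (Fin (3 + 1)) O))) (X₁ : Scheme.{0}) (τ : X₁ ⟶ (Proj (homogeneousSubmodule (Fin (3 + 1)) O))) (j₂ : F₂ ⟶ X₁) (t₂ : F₂ ⟶ Spec (.of k))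
      (𝓛 : MvPolynomial (Fin (3 + 1)) k → ((Proj (homogeneousSubmodule (Fin (3 + 1)) O))).IdealSheafData) (𝓜 : ((Proj (homogeneousSubmodule (Fin (3 + 1)) O))).IdealSheafData),
      IsIntegral F₂ ∧ IsIrreducible (closure (υ ⁻¹' (Set.range ι \ {((vanishingIdeal (⟨closure (Set.range ι), isClosed_closure⟩ : Closeds (projectiveSpace 3 k).left)).subschemeι x₀ : (projectiveSpace 3 k).left)}))) ∧ s ≫ 𝟙 (Proj (homogeneousSubmodule (Fin (3 + 1)) O)) ≫ (Proj.toSpecZero (homogeneousSubmodule (Fin (3 + 1)) O) ≫ Spec.map (CommRingCat.ofHom (algebraMap O (homogeneousSubmodule (Fin (3 + 1)) O 0)))) = 𝟙 _ ∧ s (IsLocalRing.closedPoint O) = (Proj.map φ hφ' : (projectiveSpace 3 k).left ⟶ Proj (homogeneousSubmodule (Fin (3 + 1)) O)) ((vanishingIdeal (⟨closure (Set.range ι), isClosed_closure⟩ : Closeds (projectiveSpace 3 k).left)).subschemeι x₀ : (projectiveSpace 3 k).left) ∧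
      (∀ c ∈ (s.ker.support : Set ↥(Proj (homogeneousSubmodule (Fin (3 + 1)) O))), ¬ IsGenericPoint ((𝟙 (Proj (homogeneousSubmodule (Fin (3 + 1)) O)) : _ ⟶ _) c) (Set.range (ι ≫ Proj.map φ hφ' : H ⟶ Proj (homogeneousSubmodule (Fin (3 + 1)) O)))) ∧
      IsBlowup τ s.ker ∧ j₂ ≫ τ = υ ≫ (Proj.map φ hφ' : (projectiveSpace 3 k).left ⟶ Proj (homogeneousSubmodule (Fin (3 + 1)) O)) ∧
      (s.ker.comap τ).comap j₂ = (vanishingIdeal (⟨{((vanishingIdeal (⟨closure (Set.range ι), isClosed_closure⟩ : Closeds (projectiveSpace 3 k).left)).subschemeι x₀ : (projectiveSpace 3 k).left)}, hx₀⟩ : Closeds (projectiveSpace 3 k).left)).comap υ ∧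
      Ch X₁ (τ ≫ 𝟙 (Proj (homogeneousSubmodule (Fin (3 + 1)) O))) (j₂ '' closure (υ ⁻¹' (Set.range ι \ {((vanishingIdeal (⟨closure (Set.range ι), isClosed_closure⟩ : Closeds (projectiveSpace 3 k).left)).subschemeι x₀ : (projectiveSpace 3 k).left)}))) ∧ IsIntegral X₁ ∧ IsLocallyNoetherian X₁ ∧ Scheme.IsRegular X₁ ∧ IsDominant ((τ ≫ 𝟙 (Proj (homogeneousSubmodule (Fin (3 + 1)) O))) ≫ (Proj.toSpecZero (homogeneousSubmodule (Fin (3 + 1)) O) ≫ Spec.map (CommRingCat.ofHom (algebraMap O (homogeneousSubmodule (Fin (3 + 1)) O 0))))) ∧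
      IsPullback j₂ t₂ ((τ ≫ 𝟙 (Proj (homogeneousSubmodule (Fin (3 + 1)) O))) ≫ (Proj.toSpecZero (homogeneousSubmodule (Fin (3 + 1)) O) ≫ Spec.map (CommRingCat.ofHom (algebraMap O (homogeneousSubmodule (Fin (3 + 1)) O 0))))) (Spec.map (CommRingCat.ofHom θ)) ∧
      -- the exceptional letter `E = υ⁻¹{x₀}` with the model `(ker s)·𝒪_{X₁}`
      ((s.ker.comap τ).comap j₂ = vanishingIdeal (⟨closure (υ ⁻¹' {((vanishingIdeal (⟨closure (Set.range ι), isClosed_closure⟩ : Closeds (projectiveSpace 3 k).left)).subschemeι x₀ : (projectiveSpace 3 k).left)}), isClosed_closure⟩ : Closeds F₂) ∧ (∀ z : X₁, (stalkIdeal (s.ker.comap τ) z).IsPrincipal) ∧ Scheme.IsRegular (s.ker.comap τ).subscheme ∧ ((τ ≫ 𝟙 (Proj (homogeneousSubmodule (Fin (3 + 1)) O)))) '' ((s.ker.comap τ).support : Set X₁) ⊆ {y : ↥(Proj (homogeneousSubmodule (Fin (3 + 1)) O)) | ¬ IsGenericPoint y (Set.range (ι ≫ Proj.map φ hφ' : H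 ⟶ Proj (homogeneousSubmodule (Fin (3 + 1)) O)))} ∧ Flat ((s.ker.comap τ).subschemeι ≫ ((τ ≫ 𝟙 (Proj (homogeneousSubmodule (Fin (3 + 1)) O)))) ≫ (Proj.toSpecZero (homogeneousSubmodule (Fin (3 + 1)) O) ≫ Spec.map (CommRingCat.ofHom (algebraMap O (homogeneousSubmodule (Fin (3 + 1)) O 0)))))) ∧
      -- the hyperplane letters with the models `St (𝓛 ℓ)`
      (∀ ℓ ∈ ℓh :: ℓj :: ℓs, ((strictTransformIdeal τ s.ker (𝓛 ℓ)).comap j₂ = vanishingIdeal (⟨closure (closure (υ ⁻¹' ({y : (projectiveSpace 3 k).left | ℓ ∈ (y : ProjectiveSpectrum (homogeneousSubmodule (Fin (3 + 1)) k)).asHomogeneousIdeal} \ {((vanishingIdeal (⟨closure (Set.range ι), isClosed_closure⟩ : Closeds (projectiveSpace 3 k).left)).subschemeι x₀ : (projectiveSpace 3 k).left)}))), isClosed_closure⟩ : Closeds F₂) ∧ (∀ z : X₁, (stalkIdeal (strictTransformIdeal τ s.ker (𝓛 ℓ)) z).IsPrincipal) ∧ Scheme.IsRegular (strictTransformIdeal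 τ s.ker (𝓛 ℓ)).subscheme ∧ ((τ ≫ 𝟙 (Proj (homogeneousSubmodule (Fin (3 + 1)) O)))) '' ((strictTransformIdeal τ s.ker (𝓛 ℓ)).support : Set X₁) ⊆ {y : ↥(Proj (homogeneousSubmodule (Fin (3 + 1)) O)) | ¬ IsGenericPoint y (Set.range (ι ≫ Proj.map φ hφ' : H ⟶ Proj (homogeneousSubmodule (Fin (3 + 1)) O)))} ∧ Flat ((strictTransformIdeal τ s.ker (𝓛 ℓ)).subschemeι ≫ ((τ ≫ 𝟙 (Proj (homogeneousSubmodule (Fin (3 + 1)) O)))) ≫ (Proj.toSpecZero (homogeneousSubmodule (Fin (3 + 1)) O) ≫ Spec.map (CommRingCat.ofHom (algebraMap O (homogeneousSubmodule (Fin (3 + 1)) O 0)))))) ∧ strictTransformIdeal τ s.ker (𝓛 ℓ) ≠ ⊥) ∧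
      -- the immature key letter with the model `St 𝓜`, and its G1-P incidence
      ((strictTransformIdeal τ s.ker 𝓜).comap j₂ = vanishingIdeal (⟨closure (closure (υ ⁻¹' ({y : (projectiveSpace 3 k).left | G ∈ (y : ProjectiveSpectrum (homogeneousSubmodule (Fin (3 + 1)) k)).asHomogeneousIdeal} \ {((vanishingIdeal (⟨closure (Set.range ι), isClosed_closure⟩ : Closeds (projectiveSpace 3 k).left)).subschemeι x₀ : (projectiveSpace 3 k).left)}))), isClosed_closure⟩ : Closeds F₂) ∧ (∀ z : X₁, (stalkIdeal (strictTransformIdeal τ s.ker 𝓜) z).IsPrincipal) ∧ ((τ ≫ 𝟙 (Proj (homogeneousSubmodule (Fin (3 + 1)) O)))) '' ((strictTransformIdeal τ s.ker 𝓜).support : Set X₁) ⊆ {y : ↥(Proj (homogeneousSubmodule (Fin (3 + 1)) O)) | ¬ IsGenericPoint y (Set.range (ι ≫ Proj.map φ hφ' : H ⟶ Proj (homogeneousSubmodule (Fin (3 + 1)) O)))} ∧ Flat ((strictTransformIdeal τ s.ker 𝓜).subschemeι ≫ ((τ ≫ 𝟙 (Proj (homogeneousSubmodule (Fin (3 + 1))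 O)))) ≫ (Proj.toSpecZero (homogeneousSubmodule (Fin (3 + 1)) O) ≫ Spec.map (CommRingCat.ofHom (algebraMap O (homogeneousSubmodule (Fin (3 + 1)) O 0))))) ∧ (strictTransformIdeal τ s.ker 𝓜) ≠ ⊥) ∧
      strictTransformIdeal τ s.ker 𝓜 ≤ strictTransformIdeal τ s.ker (𝓛 ℓh) ^ a ⊔ strictTransformIdeal τ s.ker (𝓛 ℓh) * s.ker.comap τ ⊔
        s.ker.comap τ * strictTransformIdeal τ s.ker (𝓛 ℓj) := by
  intro φ hφ' hφ Ch hChStep hChSplit hYsp hYirr hYcl hPint hPnoeth hPreg hqprop hqsm hCh₀ hdom₀ hF₁k t hsq₀ hT₁cl hirr hTS x₀ hx₀ hxreg hFreg F₂ υ hυ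
    ℓh ℓj ℓs G U R₁ R₂ e a hletters hGe ha hGeq hR₁ hR₂ hU hHG hrad
  classical
  letI := MvPolynomial.gradedAlgebra (σ := Fin (3 + 1)) (R := O)
  letI := MvPolynomial.gradedAlgebra (σ := Fin (3 + 1)) (R := k)
  haveI := hPint; haveI := hPnoeth; haveI := hqprop; haveI := hqsm; haveI := hF₁k
  haveI : IsClosedImmersion (Spec.map (CommRingCat.ofHom θ)) := IsClosedImmersion.spec_of_surjective _ hθ
  haveI hgci : IsClosedImmersion (Proj.map φ hφ' : (projectiveSpace 3 k).left ⟶ Proj (homogeneousSubmodule (Fin (3 + 1)) O)) := MorphismProperty.IsStableUnderBaseChange.of_isPullback hsq₀.flip inferInstance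
  have hjfin := ((IsClosedImmersion.iff_isFinite_and_mono _).mp hgci).1
  have hjft := ((IsFinite.iff_isIntegralHom_and_locallyOfFiniteType _).mp hjfin).2
  haveI : IsLocallyNoetherian (projectiveSpace 3 k).left := @LocallyOfFiniteType.isLocallyNoetherian _ _ _ hjft hPnoeth
  haveI hPkn : IsLocallyNoetherian (Proj (homogeneousSubmodule (Fin (3 + 1)) k)) := ‹IsLocallyNoetherian (projectiveSpace 3 k).left›
  haveI : IsProper (𝟙 (Proj (homogeneousSubmodule (Fin (3 + 1)) O)) ≫ (Proj.toSpecZero (homogeneousSubmodule (Fin (3 + 1)) O) ≫ Spec.map (CommRingCat.ofHom (algebraMap O (homogeneousSubmodule (Fin (3 + 1)) O 0))))) := by rw [Category.id_comp]; exact hqprop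
  haveI : IsSeparated (𝟙 (Proj (homogeneousSubmodule (Fin (3 + 1)) O)) ≫ (Proj.toSpecZero (homogeneousSubmodule (Fin (3 + 1)) O) ≫ Spec.map (CommRingCat.ofHom (algebraMap O (homogeneousSubmodule (Fin (3 + 1)) O 0))))) := inferInstance
  -- THE K5′ (Proj (homogeneousSubmodule (Fin (3 + 1)) O))INT STEP at the base stage
  obtain ⟨hF₂, hT₂irr, U', s, X₁, τ, j₂, t₂, -, -, hs, -, hss₀, hsoff, hτ, hcomm, hE, hCh₁, hint₁, hnoeth₁, hreg₁, hdom₁, hsq₂⟩ :=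
    modelPointStep_chain' O k θ hθ _ (Proj.toSpecZero (homogeneousSubmodule (Fin (3 + 1)) O) ≫ Spec.map (CommRingCat.ofHom (algebraMap O (homogeneousSubmodule (Fin (3 + 1)) O 0)))) (Set.range (ι ≫ Proj.map φ hφ' : H ⟶ Proj (homogeneousSubmodule (Fin (3 + 1)) O))) hYsp hYirr hYcl hPnoeth hPreg Ch hChSplit hChStep _ (𝟙 _) _ hCh₀ hPreg hdom₀ _ (Proj.map φ hφ' : (projectiveSpace 3 k).left ⟶ Proj (homogeneousSubmodule (Fin (3 + 1)) O)) t hsq₀ (Set.range ι)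
      hT₁cl hirr hTS x₀ hx₀ hxreg hFreg F₂ υ hυ
  haveI := hF₂; haveI := hint₁; haveI := hnoeth₁
  haveI hj₂ci : IsClosedImmersion j₂ := MorphismProperty.IsStableUnderBaseChange.of_isPullback hsq₂.flip inferInstance
  haveI : IsLocallyNoetherian F₂ := LocallyOfFiniteType.isLocallyNoetherian j₂
  have hs' : s ≫ (Proj.toSpecZero (homogeneousSubmodule (Fin (3 + 1)) O) ≫ Spec.map (CommRingCat.ofHom (algebraMap O (homogeneousSubmodule (Fin (3 + 1)) O 0)))) = 𝟙 _ := by simpa only [Category.id_comp] using hs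
  -- THE BIRTH of all models at the initial stage (IN-1)
  obtain ⟨𝓛, 𝓜, Gst, hLs, ⟨hM1, hM2, hM4, hM5⟩, hM0, hinc, hMG, hGa, hGbar⟩ :=
    hBirth O θ hθ φ hφ' hφ s hs' ((vanishingIdeal (⟨closure (Set.range ι), isClosed_closure⟩ : Closeds (projectiveSpace 3 k).left)).subschemeι x₀ : (projectiveSpace 3 k).left) hss₀ ℓh ℓj ℓs G U R₁ R₂ e a hletters hGe ha hGeq hR₁ hR₂ hU hHG hrad
  -- the section: regular kernel, flat over `O`, trace `𝓘{x₀}`, off the generic point of `Y`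
  obtain ⟨_, hsreg, -, -⟩ := section_isClosedImmersion_and_isRegular_ker O _ (𝟙 _ ≫ (Proj.toSpecZero (homogeneousSubmodule (Fin (3 + 1)) O) ≫ Spec.map (CommRingCat.ofHom (algebraMap O (homogeneousSubmodule (Fin (3 + 1)) O 0))))) s hs
  have hsflat : Flat (s.ker.subschemeι ≫ 𝟙 _ ≫ (Proj.toSpecZero (homogeneousSubmodule (Fin (3 + 1)) O) ≫ Spec.map (CommRingCat.ofHom (algebraMap O (homogeneousSubmodule (Fin (3 + 1)) O 0))))) := flat_kerSubschemeι_comp_of_section O (𝟙 _ ≫ (Proj.toSpecZero (homogeneousSubmodule (Fin (3 + 1)) O) ≫ Spec.map (CommRingCat.ofHom (algebraMap O (homogeneousSubmodule (Fin (3 + 1)) O 0))))) s hs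
  have hrange' : Set.range ((Proj.map φ hφ' : (projectiveSpace 3 k).left ⟶ Proj (homogeneousSubmodule (Fin (3 + 1)) O)) ≫ 𝟙 _ ≫ (Proj.toSpecZero (homogeneousSubmodule (Fin (3 + 1)) O) ≫ Spec.map (CommRingCat.ofHom (algebraMap O (homogeneousSubmodule (Fin (3 + 1)) O 0))))) ⊆ {closedPoint O} := by
    rintro _ ⟨y', rfl⟩
    have h1 : (Proj.map φ hφ' : (projectiveSpace 3 k).left ⟶ Proj (homogeneousSubmodule (Fin (3 + 1)) O)) y' ∈ Set.range (Proj.map φ hφ' : (projectiveSpace 3 k).left ⟶ Proj (homogeneousSubmodule (Fin (3 + 1)) O)) := ⟨y', rfl⟩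
    rw [range_eq_preimage_of_isPullback hsq₀, range_specMap_of_surjective_of_field θ hθ] at h1
    exact h1
  have hJ : s.ker.comap (Proj.map φ hφ' : (projectiveSpace 3 k).left ⟶ Proj (homogeneousSubmodule (Fin (3 + 1)) O)) = vanishingIdeal ⟨{((vanishingIdeal (⟨closure (Set.range ι), isClosed_closure⟩ : Closeds (projectiveSpace 3 k).left)).subschemeι x₀ : (projectiveSpace 3 k).left)}, hx₀⟩ :=
    ker_section_comap_eq_vanishingIdeal O _ _ (𝟙 _ ≫ (Proj.toSpecZero (homogeneousSubmodule (Fin (3 + 1)) O) ≫ Spec.map (CommRingCat.ofHom (algebraMap O (homogeneousSubmodule (Fin (3 + 1)) O 0))))) s hs (Proj.map φ hφ' : (projectiveSpace 3 k).left ⟶ Proj (homogeneousSubmodule (Fin (3 + 1)) O)) hrange' ((vanishingIdeal (⟨closure (Set.range ι), isClosed_closure⟩ : Closeds (projectiveSpace 3 k).left)).subschemeι x₀ : (projectiveSpace 3 k).left) hss₀.symm hx₀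
  have hsoffY : (𝟙 (Proj (homogeneousSubmodule (Fin (3 + 1)) O)) : _ ⟶ _) '' (s.ker.support : Set _) ⊆ {y | ¬ IsGenericPoint y (Set.range (ι ≫ Proj.map φ hφ' : H ⟶ Proj (homogeneousSubmodule (Fin (3 + 1)) O)))} := by
    rintro _ ⟨c, hc, rfl⟩; exact hsoff c hc
  -- a model off the generic point of `Y` is never `⊥`
  obtain ⟨ξ, hξ⟩ : ∃ ξ : ↥(Proj (homogeneousSubmodule (Fin (3 + 1)) O)), IsGenericPoint ξ (Set.range (ι ≫ Proj.map φ hφ' : H ⟶ Proj (homogeneousSubmodule (Fin (3 + 1)) O))) := QuasiSober.sober hYirr hYcl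
  have hne0 : ∀ II : ((Proj (homogeneousSubmodule (Fin (3 + 1)) O))).IdealSheafData, (𝟙 (Proj (homogeneousSubmodule (Fin (3 + 1)) O)) : _ ⟶ _) '' (II.support : Set _) ⊆ {y | ¬ IsGenericPoint y (Set.range (ι ≫ Proj.map φ hφ' : H ⟶ Proj (homogeneousSubmodule (Fin (3 + 1)) O)))} → II ≠ ⊥ := by
    intro II hoff h0
    have hmem : ξ ∈ (II.support : Set _) := by rw [h0, Scheme.IdealSheafData.support_bot]; trivial
    exact hoff ⟨ξ, hmem, rfl⟩ hξ
  have hC0 : s.ker ≠ ⊥ := hne0 _ hsoffY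
  -- THE EXCEPTIONAL LETTER: res-L1-w45b-lead-1's point-plane model
  obtain ⟨he1, he2, he3, he4, he5⟩ := pointPlane_model hPreg (𝟙 _ ≫ (Proj.toSpecZero (homogeneousSubmodule (Fin (3 + 1)) O) ≫ Spec.map (CommRingCat.ofHom (algebraMap O (homogeneousSubmodule (Fin (3 + 1)) O 0))))) (𝟙 _) {y | ¬ IsGenericPoint y (Set.range (ι ≫ Proj.map φ hφ' : H ⟶ Proj (homogeneousSubmodule (Fin (3 + 1)) O)))} s.ker hsreg hsflat hsoffY hτ
    hcomm hx₀ hFreg hυ hJ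
  have hEcl : (⟨closure (υ ⁻¹' {((vanishingIdeal (⟨closure (Set.range ι), isClosed_closure⟩ : Closeds (projectiveSpace 3 k).left)).subschemeι x₀ : (projectiveSpace 3 k).left)}), isClosed_closure⟩ : Closeds F₂) = ⟨υ ⁻¹' {((vanishingIdeal (⟨closure (Set.range ι), isClosed_closure⟩ : Closeds (projectiveSpace 3 k).left)).subschemeι x₀ : (projectiveSpace 3 k).left)}, hx₀.preimage υ.continuous⟩ :=
    Closeds.ext (hx₀.preimage υ.continuous).closure_eq
  -- THE HYPERPLANE LETTERS through the nested section (HT1)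
  have hLt : ∀ ℓ ∈ ℓh :: ℓj :: ℓs,
      ((strictTransformIdeal τ s.ker (𝓛 ℓ)).comap j₂ = vanishingIdeal (⟨closure (closure (υ ⁻¹' ((fun (ℓ' : MvPolynomial (Fin (3 + 1)) k) => {y : (projectiveSpace 3 k).left | ℓ' ∈ (y : ProjectiveSpectrum (homogeneousSubmodule (Fin (3 + 1)) k)).asHomogeneousIdeal}) ℓ \ {((vanishingIdeal (⟨closure (Set.range ι), isClosed_closure⟩ : Closeds (projectiveSpace 3 k).left)).subschemeι x₀ : (projectiveSpace 3 k).left)}))), isClosed_closure⟩ : Closeds F₂) ∧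
        (∀ z : X₁, (stalkIdeal (strictTransformIdeal τ s.ker (𝓛 ℓ)) z).IsPrincipal) ∧ Scheme.IsRegular (strictTransformIdeal τ s.ker (𝓛 ℓ)).subscheme ∧
        (τ ≫ 𝟙 (Proj (homogeneousSubmodule (Fin (3 + 1)) O))) '' ((strictTransformIdeal τ s.ker (𝓛 ℓ)).support : Set X₁) ⊆ {y | ¬ IsGenericPoint y (Set.range (ι ≫ Proj.map φ hφ' : H ⟶ Proj (homogeneousSubmodule (Fin (3 + 1)) O)))} ∧
        Flat ((strictTransformIdeal τ s.ker (𝓛 ℓ)).subschemeι ≫ (τ ≫ 𝟙 (Proj (homogeneousSubmodule (Fin (3 + 1)) O))) ≫ (Proj.toSpecZero (homogeneousSubmodule (Fin (3 + 1)) O) ≫ Spec.map (CommRingCat.ofHom (algebraMap O (homogeneousSubmodule (Fin (3 + 1)) O 0)))))) ∧ strictTransformIdeal τ s.ker (𝓛 ℓ) ≠ ⊥ := by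
    intro ℓ hℓ
    obtain ⟨⟨h1, h2, h3, h4, h5⟩, hle⟩ := hLs ℓ hℓ
    obtain ⟨hr, hpr, hfl, hne, htr⟩ := hostClauses_strictTransform_of_nestedSection (O := O) (k := k) (θ := θ) hθ (𝟙 (Proj (homogeneousSubmodule (Fin (3 + 1)) O))) (Proj.toSpecZero (homogeneousSubmodule (Fin (3 + 1)) O) ≫ Spec.map (CommRingCat.ofHom (algebraMap O (homogeneousSubmodule (Fin (3 + 1)) O 0)))) hPreg (Proj.map φ hφ' : (projectiveSpace 3 k).left ⟶ Proj (homogeneousSubmodule (Fin (3 + 1)) O)) t hsq₀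
      s hs τ hτ υ j₂ hcomm ((vanishingIdeal (⟨closure (Set.range ι), isClosed_closure⟩ : Closeds (projectiveSpace 3 k).left)).subschemeι x₀ : (projectiveSpace 3 k).left) hx₀ hυ hJ hss₀ (𝓛 ℓ) hle (hne0 _ h4) h3 h2 h5 (closure ((fun (ℓ' : MvPolynomial (Fin (3 + 1)) k) => {y : (projectiveSpace 3 k).left | ℓ' ∈ (y : ProjectiveSpectrum (homogeneousSubmodule (Fin (3 + 1)) k)).asHomogeneousIdeal}) ℓ)) isClosed_closure h1
    refine ⟨⟨?_, hpr, hr, ?_, hfl⟩, hne⟩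
    · have hset : closure (υ ⁻¹' (closure ((fun (ℓ' : MvPolynomial (Fin (3 + 1)) k) => {y : (projectiveSpace 3 k).left | ℓ' ∈ (y : ProjectiveSpectrum (homogeneousSubmodule (Fin (3 + 1)) k)).asHomogeneousIdeal}) ℓ) \ {((vanishingIdeal (⟨closure (Set.range ι), isClosed_closure⟩ : Closeds (projectiveSpace 3 k).left)).subschemeι x₀ : (projectiveSpace 3 k).left)})) = closure (closure (υ ⁻¹' ((fun (ℓ' : MvPolynomial (Fin (3 + 1)) k) => {y : (projectiveSpace 3 k).left | ℓ' ∈ (y : ProjectiveSpectrum (homogeneousSubmodule (Fin (3 + 1)) k)).asHomogeneousIdeal}) ℓ \ {((vanishingIdeal (⟨closure (Set.range ι), isClosed_closure⟩ : Closeds (projectiveSpace 3 k).left)).subschemeι x₀ : (projectiveSpace 3 k).left)}))) := by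
        rw [closure_closure]; exact closure_preimage_closure_diff_singleton hx₀ hυ _
      rw [htr]; congr 1; exact Closeds.ext hset
    · rintro _ ⟨z, hz, rfl⟩
      have hle' : (𝓛 ℓ).comap τ ≤ strictTransformIdeal τ s.ker (𝓛 ℓ) := by
        rw [← controlledTransform_zero τ s.ker (𝓛 ℓ)]; exact controlledTransform_le_strictTransformIdeal τ s.ker (𝓛 ℓ) 0
      have hz' : τ z ∈ ((𝓛 ℓ).support : Set _) := by
        have h1 : z ∈ (((𝓛 ℓ).comap τ).support : Set X₁) := Scheme.IdealSheafData.support_antitone hle' hz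
        rwa [support_comap] at h1
      exact h4 ⟨τ z, hz', rfl⟩
  -- THE IMMATURE KEY LETTER through the point step (Δ2a)
  obtain ⟨hS2, hS5, hS0, hS4, hS1⟩ := preLetterClauses_strictTransform_of_section (O := O) (k := k) (θ := θ) hθ (𝟙 (Proj (homogeneousSubmodule (Fin (3 + 1)) O))) (Set.range (ι ≫ Proj.map φ hφ' : H ⟶ Proj (homogeneousSubmodule (Fin (3 + 1)) O))) (Proj.toSpecZero (homogeneousSubmodule (Fin (3 + 1)) O) ≫ Spec.map (CommRingCat.ofHom (algebraMap O (homogeneousSubmodule (Fin (3 + 1)) O 0)))) hPreg (Proj.map φ hφ' : (projectiveSpace 3 k).left ⟶ Proj (homogeneousSubmodule (Fin (3 + 1)) O)) t hsq₀ s hs hC0 τ hτ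
    υ j₂ hcomm ((vanishingIdeal (⟨closure (Set.range ι), isClosed_closure⟩ : Closeds (projectiveSpace 3 k).left)).subschemeι x₀ : (projectiveSpace 3 k).left) hx₀ hυ hJ hss₀ 𝓜 hM0 hM2 hM5 hM4 (closure ((fun (ℓ' : MvPolynomial (Fin (3 + 1)) k) => {y : (projectiveSpace 3 k).left | ℓ' ∈ (y : ProjectiveSpectrum (homogeneousSubmodule (Fin (3 + 1)) k)).asHomogeneousIdeal}) G)) isClosed_closure hM1 hMG hGa hGbar
  -- THE G1-P INCIDENCE (IN-2); the upstairs exact-order datum from the downstairs one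
  obtain ⟨⟨hh1, hh2, hh3, hh4, hh5⟩, hleh⟩ := hLs ℓh (by simp)
  obtain ⟨⟨hj1, hj2, hj3, hj4, hj5⟩, hlej⟩ := hLs ℓj (by simp)
  have hGup : Gst ∉ maximalIdeal (((Proj (homogeneousSubmodule (Fin (3 + 1)) O))).presheaf.stalk ((Proj.map φ hφ' : (projectiveSpace 3 k).left ⟶ Proj (homogeneousSubmodule (Fin (3 + 1)) O)) ((vanishingIdeal (⟨closure (Set.range ι), isClosed_closure⟩ : Closeds (projectiveSpace 3 k).left)).subschemeι x₀ : (projectiveSpace 3 k).left))) ^ (a + 1) := by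
    intro hmem
    apply hGbar
    have hsurj := stalkMap_model_surjective θ hθ (𝟙 _ ≫ (Proj.toSpecZero (homogeneousSubmodule (Fin (3 + 1)) O) ≫ Spec.map (CommRingCat.ofHom (algebraMap O (homogeneousSubmodule (Fin (3 + 1)) O 0))))) (Proj.map φ hφ' : (projectiveSpace 3 k).left ⟶ Proj (homogeneousSubmodule (Fin (3 + 1)) O)) t hsq₀ ((vanishingIdeal (⟨closure (Set.range ι), isClosed_closure⟩ : Closeds (projectiveSpace 3 k).left)).subschemeι x₀ : (projectiveSpace 3 k).left)
    have h1 : ((Proj.map φ hφ' : (projectiveSpace 3 k).left ⟶ Proj (homogeneousSubmodule (Fin (3 + 1)) O)).stalkMap ((vanishingIdeal (⟨closure (Set.range ι), isClosed_closure⟩ : Closeds (projectiveSpace 3 k).left)).subschemeι x₀ : (projectiveSpace 3 k).left)).hom Gst ∈ (maximalIdeal _ ^ (a + 1)).map ((Proj.map φ hφ' : (projectiveSpace 3 k).left ⟶ Proj (homogeneousSubmodule (Fin (3 + 1)) O)).stalkMap ((vanishingIdeal (⟨closure (Set.range ι), isClosed_closure⟩ : Closeds (projectiveSpace 3 k).left)).subschemeι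 x₀ : (projectiveSpace 3 k).left)).hom := Ideal.mem_map_of_mem _ hmem
    rwa [Ideal.map_pow, map_maximalIdeal_of_surjective _ hsurj] at h1
  have hincS := hG1P O hPreg (𝟙 _ ≫ (Proj.toSpecZero (homogeneousSubmodule (Fin (3 + 1)) O) ≫ Spec.map (CommRingCat.ofHom (algebraMap O (homogeneousSubmodule (Fin (3 + 1)) O 0))))) s hs τ hτ (𝓛 ℓh) (𝓛 ℓj) 𝓜 a ((Proj.map φ hφ' : (projectiveSpace 3 k).left ⟶ Proj (homogeneousSubmodule (Fin (3 + 1)) O)) ((vanishingIdeal (⟨closure (Set.range ι), isClosed_closure⟩ : Closeds (projectiveSpace 3 k).left)).subschemeι x₀ : (projectiveSpace 3 k).left)) hss₀ hleh hlej hh3 hh2 hj3 hj2 hM2 hM0 ⟨Gst, hMG, hGa, hGup⟩ hinc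
  refine ⟨s, X₁, τ, j₂, t₂, 𝓛, 𝓜, hF₂, hT₂irr, hs, hss₀, hsoff, hτ, hcomm, hE, hCh₁, hint₁, hnoeth₁, hreg₁, hdom₁, hsq₂,
    ⟨?_, he2, he3, he4, ?_⟩, hLt, ⟨?_, hS2, hS4, hS5, hS0⟩, hincS⟩
  · rw [hEcl]; exact he1
  · simpa only [Category.assoc] using he5
  · have hset : closure (υ ⁻¹' (closure ((fun (ℓ' : MvPolynomial (Fin (3 + 1)) k) => {y : (projectiveSpace 3 k).left | ℓ' ∈ (y : ProjectiveSpectrum (homogeneousSubmodule (Fin (3 + 1)) k)).asHomogeneousIdeal}) G) \ {((vanishingIdeal (⟨closure (Set.range ι), isClosed_closure⟩ : Closeds (projectiveSpace 3 k).left)).subschemeι x₀ : (projectiveSpace 3 k).left)})) = closure (closure (υ ⁻¹' ((fun (ℓ' : MvPolynomial (Fin (3 + 1)) k) => {y : (projectiveSpace 3 k).left | ℓ' ∈ (y : ProjectiveSpectrum (homogeneousSubmodule (Fin (3 + 1)) k)).asHomogeneousIdeal}) G \ {((vanishingIdeal (⟨closure (Set.range ι), isClosed_closure⟩ : Closeds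 (projectiveSpace 3 k).left)).subschemeι x₀ : (projectiveSpace 3 k).left)}))) := by
      rw [closure_closure]; exact closure_preimage_closure_diff_singleton hx₀ hυ _
    rw [hS1]; congr 1; exact Closeds.ext hset

end Summit.ResolutionOfSingularities.ResolutionOfSingularities.Cruxes.EquisingularLiftNat.Sections

end
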